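import Summits.Ventures.PercRepro.PuncturedLYMChainAssembly

/-!
# PercRepro — (SP) BY SUPERPOSITION, PART 14: THE POINT-AVOIDING REFINEMENT — THE WORDS THROUGH THE COMPLETING POINT
HELP (p10, gen 32)

At a completion `X ↦ insert y X` every word THROUGH `y` contributes `+g(a) ≥ 0` to the superposition, so only the words
AVOIDING `y` count in the deficit (PuncturedLYMAvoidBound: `superW_ge_avoid`, `max_errE_le_avoid`).  The words
avoiding `y` at distance `a` and `a + 1` from `X` compete for the `(j−1)`-sets AVOIDING `y` that meet `X` in `a` points,
of which there are at most `C(j,a)·C(n−j−1, j−1−a)` (`card_midSetsAvoid_le`, `card_avoid_pair_le`), so a profile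
certificate `λ` bounds the avoiding deficit by `Σ_{a<j} λ_a·sʸ_a` with the SMALLER counts
`sʸ_a = C(j,a)·C(n−j−1, j−1−a)` (`sum_eDef_avoid_le_of_cert`, `sum_eDef_avoid_le_of_cert_of_no_near`).
THIS FILE: the counts and the certificate bounds.  The refined superposition / error bounds and the assembly
**`puncturedNMP_of_cert3`** are PuncturedLYMAvoidBound.  Nothing here asserts (SP) in general.
-/

namespace PercRepro.PuncturedLYM

open Finset

variable {α : Type} [Fintype α] [DecidableEq α]

/-! ### The `(j−1)`-sets avoiding a point -/

/-- The `(j−1)`-sets meeting `X` in `a` points and avoiding `y`. -/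
def midSetsAvoid (α : Type) [Fintype α] [DecidableEq α] (j : ℕ) (X : Finset α) (y : α) (a : ℕ) :
    Finset (Finset α) :=
  ((univ : Finset α).powersetCard (j - 1)).filter (fun S => y ∉ S ∧ (S ∩ X).card = a)

/-- `#midSetsAvoid ≤ C(j, a)·C(n − j − 1, j − 1 − a)` for a `j`-set `X` and `y ∉ X` (`a + 1 ≤ j`): `S ↦ (S ∩ X, S ∖ X)` is
injective into `X.powersetCard a × (univ ∖ insert y X).powersetCard (j − 1 − a)`. -/
theorem card_midSetsAvoid_le {j : ℕ} {X : Finset α} (hX : X.card = j) {y : α} (hy : y ∉ X) {a : ℕ}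
    (ha : a + 1 ≤ j) :
    (midSetsAvoid α j X y a).card ≤ j.choose a * (Fintype.card α - j - 1).choose (j - 1 - a) := by
  have hinj : Set.InjOn (fun S : Finset α => (S ∩ X, S \ X)) (midSetsAvoid α j X y a : Set (Finset α)) := by
    intro S _ T _ h
    simp only [Prod.mk.injEq] at h
    ext w
    by_cases hwX : w ∈ X
    · have h1 : w ∈ S ↔ w ∈ S ∩ X := by simp [hwX]
      have h2 : w ∈ T ↔ w ∈ T ∩ X := by simp [hwX]
      rw [h1, h2, h.1]
    · have h1 : w ∈ S ↔ w ∈ S \ X := by simp [hwX]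
      have h2 : w ∈ T ↔ w ∈ T \ X := by simp [hwX]
      rw [h1, h2, h.2]
  have hsub : (midSetsAvoid α j X y a).image (fun S : Finset α => (S ∩ X, S \ X)) ⊆
      (X.powersetCard a) ×ˢ ((univ \ insert y X).powersetCard (j - 1 - a)) := by
    intro p hp
    rw [mem_image] at hp
    obtain ⟨S, hS, rfl⟩ := hp
    simp only [midSetsAvoid, mem_filter, mem_powersetCard] at hS
    rw [mem_product, mem_powersetCard, mem_powersetCard]
    refine ⟨⟨inter_subset_right, hS.2.2⟩, ⟨?_, ?_⟩⟩
    · intro w hw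
      rw [mem_sdiff] at hw ⊢
      refine ⟨mem_univ w, ?_⟩
      rw [mem_insert, not_or]
      exact ⟨fun h => hS.2.1 (h ▸ hw.1), hw.2⟩
    · show (S \ X).card = j - 1 - a
      have := card_sdiff_add_card_inter S X
      omega
  calc (midSetsAvoid α j X y a).card
      = ((midSetsAvoid α j X y a).image (fun S : Finset α => (S ∩ X, S \ X))).card :=
        (card_image_of_injOn hinj).symm
    _ ≤ ((X.powersetCard a) ×ˢ ((univ \ insert y X).powersetCard (j - 1 - a))).card := card_le_card hsub
    _ = j.choose a * (Fintype.card α - j - 1).choose (j - 1 - a) := by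
        rw [card_product, card_powersetCard, card_powersetCard, hX, card_univ_sdiff,
          card_insert_of_notMem hy, hX]
        rfl

/-! ### The words avoiding a point -/

/-- The words of `D` avoiding `y` at distance `a` from `X`. -/
def avoidCount (D : Finset (Finset α)) (X : Finset α) (y : α) (a : ℕ) : ℕ :=
  (D.filter (fun B => y ∉ B ∧ (X ∩ B).card = a)).card

omit [Fintype α] in
/-- The words of a code avoiding a point form a code. -/
theorem isCode_filter_avoid {j : ℕ} {D : Finset (Finset α)} (hD : IsCode j D) (y : α) :
    IsCode j (D.filter (fun B => y ∉ B)) :=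
  ⟨fun B hB => hD.1 B (mem_filter.1 hB).1,
   fun B hB B' hB' hne => hD.2 B (mem_filter.1 hB).1 B' (mem_filter.1 hB').1 hne⟩

/-- **The joint packing count for the words avoiding `y`**: `(j − a)·mʸ_a + (a + 1)·mʸ_{a+1} ≤ #midSetsAvoid a` for a
code `D`, a `j`-set `X`, any point `y` and `a < j`: the map `(B, p) ↦ B ∖ p` on the pairs of the sub-code of the words avoiding
`y` is injective into the `(j−1)`-sets avoiding `y` that meet `X` in `a` points. -/
theorem card_avoid_pair_le {j : ℕ} {D : Finset (Finset α)} (hD : IsCode j D) {X : Finset α} (hX : X.card = j)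
    (y : α) {a : ℕ} (ha : a < j) :
    avoidCount D X y a * (j - a) + avoidCount D X y (a + 1) * (a + 1) ≤ (midSetsAvoid α j X y a).card := by
  have hD' : IsCode j (D.filter (fun B => y ∉ B)) := isCode_filter_avoid hD y
  have h1 : avoidCount D X y a = ((D.filter (fun B => y ∉ B)).filter (fun B => (X ∩ B).card = a)).card := by
    unfold avoidCount
    rw [filter_filter]
  have h2 : avoidCount D X y (a + 1) =
      ((D.filter (fun B => y ∉ B)).filter (fun B => (X ∩ B).card = a + 1)).card := by
    unfold avoidCount
    rw [filter_filter]
  rw [h1, h2, ← card_pairs hD' X ha]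
  have hinj : Set.InjOn (fun p : Σ _ : Finset α, α => p.1.erase p.2)
      (pairs (D.filter (fun B => y ∉ B)) X a : Set _) := by
    rintro ⟨B, p⟩ hp ⟨B', p'⟩ hp' h
    simp only [mem_coe, pairs, mem_union, mem_sigma, mem_filter] at hp hp'
    have h' : B.erase p = B'.erase p' := h
    have hBD : B ∈ D := by rcases hp with ⟨⟨⟨h, -⟩, -⟩, -⟩ | ⟨⟨⟨h, -⟩, -⟩, -⟩ <;> exact h
    have hB'D : B' ∈ D := by rcases hp' with ⟨⟨⟨h, -⟩, -⟩, -⟩ | ⟨⟨⟨h, -⟩, -⟩, -⟩ <;> exact h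
    have hpB : p ∈ B := by
      rcases hp with ⟨-, h⟩ | ⟨-, h⟩
      · exact (mem_sdiff.1 h).1
      · exact (mem_inter.1 h).1
    have hp'B : p' ∈ B' := by
      rcases hp' with ⟨-, h⟩ | ⟨-, h⟩
      · exact (mem_sdiff.1 h).1
      · exact (mem_inter.1 h).1
    have hBB' : B = B' := by
      by_contra hne
      have h1 := hD.2 B hBD B' hB'D hne
      have h2 : B.erase p ⊆ B ∩ B' := by
        intro w hw
        rw [mem_inter]
        refine ⟨mem_of_mem_erase hw, ?_⟩
        rw [h'] at hw
        exact mem_of_mem_erase hw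
      have := card_le_card h2
      rw [card_erase_of_mem hpB, hD.1 B hBD] at this
      omega
    subst hBB'
    have hpp' : p = p' := erase_injOn B hpB hp'B h'
    rw [hpp']
  have hsub : (pairs (D.filter (fun B => y ∉ B)) X a).image (fun p : Σ _ : Finset α, α => p.1.erase p.2) ⊆
      midSetsAvoid α j X y a := by
    intro S hS
    rw [mem_image] at hS
    obtain ⟨⟨B, p⟩, hp, rfl⟩ := hS
    simp only [pairs, mem_union, mem_sigma, mem_filter] at hp
    rw [midSetsAvoid, mem_filter, mem_powersetCard]
    rcases hp with ⟨⟨⟨hBD, hyB⟩, hBa⟩, hp⟩ | ⟨⟨⟨hBD, hyB⟩, hBa⟩, hp⟩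
    · -- distance `a`, `p ∉ X`
      have hpB : p ∈ B := (mem_sdiff.1 hp).1
      have hpX : p ∉ X := (mem_sdiff.1 hp).2
      refine ⟨⟨subset_univ _, by rw [card_erase_of_mem hpB, hD.1 B hBD]⟩, fun h => hyB (mem_of_mem_erase h), ?_⟩
      have : B.erase p ∩ X = X ∩ B := by
        ext w
        simp only [mem_inter, mem_erase]
        constructor
        · rintro ⟨⟨-, hwB⟩, hwX⟩
          exact ⟨hwX, hwB⟩
        · rintro ⟨hwX, hwB⟩
          exact ⟨⟨fun h => hpX (h ▸ hwX), hwB⟩, hwX⟩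
      rw [this, hBa]
    · -- distance `a + 1`, `p ∈ X`
      have hpB : p ∈ B := (mem_inter.1 hp).1
      have hpX : p ∈ X := (mem_inter.1 hp).2
      refine ⟨⟨subset_univ _, by rw [card_erase_of_mem hpB, hD.1 B hBD]⟩, fun h => hyB (mem_of_mem_erase h), ?_⟩
      have : B.erase p ∩ X = (X ∩ B).erase p := by
        ext w
        simp only [mem_inter, mem_erase]
        tauto
      rw [this, card_erase_of_mem (mem_inter.2 ⟨hpX, hpB⟩), hBa]
      rfl
  calc (pairs (D.filter (fun B => y ∉ B)) X a).card
      = ((pairs (D.filter (fun B => y ∉ B)) X a).image (fun p : Σ _ : Finset α, α => p.1.erase p.2)).card :=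
        (card_image_of_injOn hinj).symm
    _ ≤ (midSetsAvoid α j X y a).card := card_le_card hsub

/-! ### The avoiding certificate bound -/

/-- The avoiding count `sʸ_a = C(j, a)·C(n − j − 1, j − 1 − a)` as a rational. -/
def sQy (α : Type) [Fintype α] (j a : ℕ) : ℚ :=
  ((j.choose a * (Fintype.card α - j - 1).choose (j - 1 - a) : ℕ) : ℚ)

/-- **The avoiding certificate bound, general form**: for a code `D`, a `j`-set `X ∉ D`, a point `y ∉ X`, a certificate
`λ ≥ 0` with `e(a) ≤ (j − a)·λ_a + a·λ_{a−1}` on `a < j`, and `1 ≤ K ≤ j` such that no word avoiding `y` is at distance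
`≥ K` from `X`: `Σ_{B ∈ D, y ∉ B} e(#(X ∩ B)) ≤ Σ_{a<K} λ_a·sʸ_a`. -/
theorem sum_eDef_avoid_le_of_cert_aux {j : ℕ} {D : Finset (Finset α)} (hD : IsCode j D)
    {X : Finset α} (hX : X.card = j) {y : α} (hy : y ∉ X) (lam : ℕ → ℚ)
    (hlam : ∀ a, a < j → 0 ≤ lam a)
    (hcert : ∀ a, a < j → eDef α j a ≤ ((j : ℚ) - a) * lam a + (a : ℚ) * lam (a - 1))
    {K : ℕ} (hK1 : 1 ≤ K) (hKj : K ≤ j) (htop : ∀ a, K ≤ a → avoidCount D X y a = 0) :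
    ∑ B ∈ D.filter (fun B => y ∉ B), eDef α j (X ∩ B).card ≤ ∑ a ∈ range K, lam a * sQy α j a := by
  -- fibres by the distance `a < K`
  have hmaps : ∀ B ∈ D.filter (fun B => y ∉ B), (X ∩ B).card ∈ range K := by
    intro B hB
    rw [mem_filter] at hB
    rw [mem_range]
    by_contra h
    have h0 := htop _ (Nat.le_of_not_lt h)
    unfold avoidCount at h0
    rw [card_eq_zero, filter_eq_empty_iff] at h0
    exact h0 hB.1 ⟨hB.2, rfl⟩
  rw [← sum_fiberwise_of_maps_to hmaps]
  have hfib : ∀ a ∈ range K,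
      ∑ B ∈ (D.filter (fun B => y ∉ B)).filter (fun B => (X ∩ B).card = a), eDef α j (X ∩ B).card =
        (avoidCount D X y a : ℚ) * eDef α j a := by
    intro a _
    unfold avoidCount
    rw [filter_filter, ← nsmul_eq_mul, ← sum_const]
    apply sum_congr rfl
    intro B hB
    rw [(mem_filter.1 hB).2.2]
  rw [sum_congr rfl hfib]
  set m : ℕ → ℚ := fun a => (avoidCount D X y a : ℚ) with hm
  have hmm : ∀ a, 0 ≤ m a := fun a => by rw [hm]; positivity
  have hmtop : ∀ a, K ≤ a → m a = 0 := by
    intro a ha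
    rw [hm]
    simp only
    rw [Nat.cast_eq_zero]
    exact htop a ha
  -- the packing counts in `ℚ`
  have hpack : ∀ a, ((j : ℚ) - a) * m a + ((a : ℚ) + 1) * m (a + 1) ≤ sQy α j a := by
    intro a
    rcases Nat.lt_or_ge a j with ha | ha
    · have h := card_avoid_pair_le hD hX y ha
      have h2 := card_midSetsAvoid_le hX hy (a := a) (by omega)
      have h3 : (((avoidCount D X y a * (j - a) + avoidCount D X y (a + 1) * (a + 1)) : ℕ) : ℚ) ≤
          ((j.choose a * (Fintype.card α - j - 1).choose (j - 1 - a) : ℕ) : ℚ) := by exact_mod_cast h.trans h2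
      rw [hm]
      simp only
      unfold sQy
      push_cast [Nat.cast_sub ha.le] at h3 ⊢
      linarith
    · have hm0 : m a = 0 := hmtop a (by omega)
      have hm1 : m (a + 1) = 0 := hmtop (a + 1) (by omega)
      rw [hm0, hm1, mul_zero, mul_zero, add_zero]
      unfold sQy
      positivity
  -- the padded certificate and weights
  set lam' : ℕ → ℚ := fun a => if a < j then lam a else 0 with hlam'
  have hlam'0 : ∀ a, 0 ≤ lam' a := by
    intro a
    rw [hlam']
    simp only
    split_ifs with h
    · exact hlam a h
    · exact le_rfl
  set w : ℕ → ℚ := fun a => if a < j then eDef α j a else 0 with hw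
  have hA : ∀ a, (fun a : ℕ => (j : ℚ) - a) a * m a + (fun a : ℕ => (a : ℚ) + 1) a * m (a + 1) ≤ sQy α j a :=
    fun a => hpack a
  have hc0 : w 0 ≤ ((j : ℚ) - (0 : ℕ)) * lam' 0 := by
    rw [hw, hlam']
    simp only [Nat.cast_zero, sub_zero]
    by_cases h : 0 < j
    · rw [if_pos h, if_pos h]
      have := hcert 0 h
      simp only [Nat.cast_zero, sub_zero, zero_mul, add_zero] at this
      exact this
    · rw [if_neg h, if_neg h, mul_zero]
  have hcs : ∀ a, w (a + 1) ≤ ((j : ℚ) - ((a + 1 : ℕ) : ℚ)) * lam' (a + 1) + ((a : ℚ) + 1) * lam' a := by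
    intro a
    rw [hw, hlam']
    simp only
    by_cases h : a + 1 < j
    · rw [if_pos h, if_pos h, if_pos (by omega)]
      have := hcert (a + 1) h
      rw [Nat.add_sub_cancel] at this
      push_cast at this ⊢
      linarith
    · rw [if_neg h, if_neg h, mul_zero, zero_add]
      by_cases h2 : a < j
      · rw [if_pos h2]
        exact mul_nonneg (by positivity) (hlam a h2)
      · rw [if_neg h2, mul_zero]
  have key := cert_sum_le m w (sQy α j) (fun a => (j : ℚ) - a) (fun a => (a : ℚ) + 1) lam' hmm hlam'0 hA hc0
    hcs K hK1
  rw [hmtop K le_rfl, mul_zero, add_zero] at key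
  have hl : ∑ a ∈ range K, m a * w a = ∑ a ∈ range K, m a * eDef α j a := by
    apply sum_congr rfl
    intro a ha
    rw [hw]
    simp only
    rw [if_pos (by have := mem_range.1 ha; omega)]
  have hr : ∑ a ∈ range K, lam' a * sQy α j a = ∑ a ∈ range K, lam a * sQy α j a := by
    apply sum_congr rfl
    intro a ha
    rw [hlam']
    simp only
    rw [if_pos (by have := mem_range.1 ha; omega)]
  rw [hl, hr] at key
  exact key

/-- **The avoiding certificate bound**: for a code `D`, a `j`-set `X ∉ D`, `y ∉ X` and `λ ≥ 0` with
`e(a) ≤ (j − a)·λ_a + a·λ_{a−1}` on `a < j`: `Σ_{B ∈ D, y ∉ B} e(#(X ∩ B)) ≤ Σ_{a<j} λ_a·sʸ_a` (`1 ≤ j`). -/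
theorem sum_eDef_avoid_le_of_cert {j : ℕ} {D : Finset (Finset α)} (hD : IsCode j D) (hj : 1 ≤ j)
    {X : Finset α} (hX : X.card = j) (hXD : X ∉ D) {y : α} (hy : y ∉ X) (lam : ℕ → ℚ)
    (hlam : ∀ a, a < j → 0 ≤ lam a)
    (hcert : ∀ a, a < j → eDef α j a ≤ ((j : ℚ) - a) * lam a + (a : ℚ) * lam (a - 1)) :
    ∑ B ∈ D.filter (fun B => y ∉ B), eDef α j (X ∩ B).card ≤ ∑ a ∈ range j, lam a * sQy α j a := by
  apply sum_eDef_avoid_le_of_cert_aux hD hX hy lam hlam hcert hj le_rfl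
  intro a ha
  unfold avoidCount
  rw [card_eq_zero, filter_eq_empty_iff]
  intro B hB h
  obtain ⟨-, h⟩ := h
  have := aOf_lt (hD.1 B hB) hX (fun h' => hXD (h' ▸ hB))
  unfold aOf at this
  omega

/-- **The avoiding certificate bound without the top class**: if no word is near `X`,
`Σ_{B ∈ D, y ∉ B} e(#(X ∩ B)) ≤ Σ_{a<j−1} λ_a·sʸ_a` (`2 ≤ j`). -/
theorem sum_eDef_avoid_le_of_cert_of_no_near {j : ℕ} {D : Finset (Finset α)} (hD : IsCode j D) (hj : 2 ≤ j)
    {X : Finset α} (hX : X.card = j) (hXD : X ∉ D) {y : α} (hy : y ∉ X)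
    (hnear : ∀ B ∈ D, (X ∩ B).card + 1 ≠ j) (lam : ℕ → ℚ) (hlam : ∀ a, a < j → 0 ≤ lam a)
    (hcert : ∀ a, a < j → eDef α j a ≤ ((j : ℚ) - a) * lam a + (a : ℚ) * lam (a - 1)) :
    ∑ B ∈ D.filter (fun B => y ∉ B), eDef α j (X ∩ B).card ≤ ∑ a ∈ range (j - 1), lam a * sQy α j a := by
  apply sum_eDef_avoid_le_of_cert_aux hD hX hy lam hlam hcert (by omega) (by omega)
  intro a ha
  unfold avoidCount
  rw [card_eq_zero, filter_eq_empty_iff]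
  intro B hB h
  obtain ⟨-, h⟩ := h
  have := aOf_lt (hD.1 B hB) hX (fun h' => hXD (h' ▸ hB))
  unfold aOf at this
  have := hnear B hB
  omega

end PercRepro.PuncturedLYM
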